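import Summits.AtomisticToContinuum.BoseEinsteinCondensation.Theorems.BlockLatticeFSumBlockCondensationCellNTransportSlices

/-!
# `BlockCondensation` (stmt-AtomisticToContinuum-13595) — P1, module B: `CellNEngine`, the deterministic floor inequality
# `natCast_le_sum_occupation_add_budget` TRANSPORTED to the cellN carrier (decomp-a2c, hand-2 g8; lens-6 g28 memo §2 E1/E2, spec `CellNEngine`)

`cellN_engine` is, binder for binder, the BODY of lens-6 g28's `CellNEngine` (`BlockCondensationCellNEngine.lean`): LSSY's mechanism
(5.15)–(5.17) run sub-cell by sub-cell, for a `C¹` Bose-symmetric `ψ` normalised on `[0,L)^{3(n+1)}`, `L = Ks`, with the PLAIN cell energy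
budget `∫_{cellN} (|∇ψ|² + Σv|ψ|²) ≤ U` and the occupations of `1_{cellN} ψ`; every other binder (Lemma 4.1 shape `h41`, excluded volume `hW`,
`hy`, localized / Neumann lower bounds `hloc` / `hE0`, bookkeeping `hcomb`, `hκ`, `hUBA`) verbatim.  Conclusion
`N ≤ ∑_q ⟨u_q, γ u_q⟩ + (2Cs²(U + B − A) + CwU)`.  The proof is the tree's (`BoseGasSubcellCondensationSharp.lean` :93–306) with the four
carrier-dependent inputs replaced by module A's `…_cellN` lemmas; `cellN_floor_of_budget` is the `(1−η)N` form (E2).  So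
`cellNEngine_holds : CellNEngine := cellN_engine` is one line once the spec lands.  `[folklore]` / [LSSY2005]; no definitions, no `sorry`.
-/

noncomputable section

open MeasureTheory Filter Set Metric
open scoped ENNReal NNReal Topology BigOperators

namespace Summit.AtomisticToContinuum.BoseEinsteinCondensation.Theorems.BlockLatticeFSumBlockCondensationCellNTransport

open Literature.MathematicalPhysics.QuantumManyBody.BoseGas
open Summit.AtomisticToContinuum.BoseEinsteinCondensation.Theorems.BlockLatticeFSumBlockCondensationCellNTransportSlices

/-- **`CellNEngine` (the deterministic floor inequality on the cellN carrier)** — statement = lens-6 g28's `CellNEngine`, verbatim.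
[cite: LSSY2005, Lemma 5.2 (5.7)–(5.14), (5.15)–(5.17); folklore (carrier form)] -/
theorem cellN_engine :
    ∀ (n K : ℕ) (s L : ℝ), 0 < s → 0 < K → (K : ℝ) * s = L → 0 < L →
    ∀ (v : ℝ → ℝ≥0∞), Measurable v →
    ∀ (ψ : Config (n + 1) → ℂ), ContDiff ℝ 1 ψ →
      (∀ (σ : Equiv.Perm (Fin (n + 1))) (X : Config (n + 1)), ψ (X ∘ σ) = ψ X) →
      ∫⁻ X in cellN (n + 1) L, (‖ψ X‖₊ : ℝ≥0∞) ^ 2 = 1 →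
    ∀ (good : ℕ → Prop) [DecidablePred good] (Rf yf lb : ℕ → ℝ) (C w Ur A B κ : ℝ),
      0 ≤ C → 0 ≤ w → 0 ≤ Ur → 0 ≤ A → 0 ≤ B →
      (∀ (L : ℝ), 0 < L → ∀ (f : Space → ℂ), ContDiff ℝ 1 f →
        ∀ (Ω : Set Space), MeasurableSet Ω → Ω ⊆ cell L →
          ∫⁻ x in cell L, (‖f x - ⨍ y in cell L, f y‖₊ : ℝ≥0∞) ^ 2 ≤
            ENNReal.ofReal C *
              (ENNReal.ofReal (L ^ 2) * (∫⁻ x in Ω, gradSqC f x) +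
                volume (cell L \ Ω) ^ (2 / 3 : ℝ) * ∫⁻ x in cell L, gradSqC f x)) →
      (∀ m : ℕ, good (m + 1) →
        ((m : ℝ≥0∞) * (ENNReal.ofReal (Rf (m + 1)) ^ 3 * ENNReal.ofReal (Real.pi * 4 / 3))) ^
          (2 / 3 : ℝ) ≤ ENNReal.ofReal w) →
      (∀ m, good m → 0 ≤ yf m ∧ yf m ≤ 1 / 2) →
      (∀ m, good m → ENNReal.ofReal (lb m) ≤ locGroundStateEnergy (yf m) (Rf m) v m s) →
      (∀ m, ¬ good m → ENNReal.ofReal (lb m) ≤ neumannGroundStateEnergy v m s) →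
      (∀ nv : Fin (K ^ 3) → ℕ, ∑ c, nv c = n + 1 →
        ENNReal.ofReal A + ENNReal.ofReal κ * ∑ c, (if good (nv c) then 0 else (nv c : ℝ≥0∞)) ≤
          (∑ c, ENNReal.ofReal (lb (nv c))) + ENNReal.ofReal B) →
      1 ≤ 2 * C * s ^ 2 * κ →
      ∫⁻ X in cellN (n + 1) L, kineticDensity ψ X + interaction v X * (‖ψ X‖₊ : ℝ≥0∞) ^ 2 ≤
        ENNReal.ofReal Ur →
      A ≤ Ur + B →
      ((n + 1 : ℕ) : ℝ≥0∞) ≤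
        (∑ q : SubIdx K, occupation (n + 1) (subMode s q) ((cellN (n + 1) L).indicator ψ)) +
          ENNReal.ofReal (2 * C * s ^ 2 * (Ur + B - A) + C * w * Ur) := by
  intro n K s L hs hK hKs hL v hv ψ hψ hsymm hnorm good _ Rf yf lb C w Ur A B κ hC hw hUr hA hB h41 hW hy hloc hE0
    hcomb hκ hE hUBA
  have hcont : Continuous ψ := hψ.continuous
  -- abbreviations: mass, group energy, outside kinetic energy of a group, per assignment and cell
  set mass : (Fin (n + 1) → Fin (K ^ 3)) → ℝ≥0∞ := fun σ =>
    ∫⁻ X in cellSet K s σ, (‖ψ X‖₊ : ℝ≥0∞) ^ 2 with hmass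
  set Egrp : (Fin (n + 1) → Fin (K ^ 3)) → Fin (K ^ 3) → ℝ≥0∞ := fun σ c =>
    ∫⁻ X in cellSet K s σ, kineticOn ((Finset.univ.filter (σ · = c)).orderEmbOfFin rfl) ψ X +
      interactionOn ((Finset.univ.filter (σ · = c)).orderEmbOfFin rfl) v X *
        (‖ψ X‖₊ : ℝ≥0∞) ^ 2 with hEgrp
  set fout : (Fin (n + 1) → Fin (K ^ 3)) → Fin (K ^ 3) → Config (n + 1) → ℝ≥0∞ := fun σ c X =>
    ∑ i : Fin (Finset.univ.filter (σ · = c)).card,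
      (nearSetOn ((Finset.univ.filter (σ · = c)).orderEmbOfFin rfl).toEmbedding
        (Rf (Finset.univ.filter (σ · = c)).card) i)ᶜ.indicator
        (partialGradSq (((Finset.univ.filter (σ · = c)).orderEmbOfFin rfl) i) ψ) X
    with hfout
  have hmfout : ∀ σ c, Measurable (fout σ c) := fun σ c =>
    Finset.measurable_sum _ fun i _ =>
      (measurable_partialGradSq _ ψ).indicator (measurableSet_nearSetOn _ _ i).compl
  set Nbad : (Fin (n + 1) → Fin (K ^ 3)) → ℝ≥0∞ := fun σ =>
    ∑ c, (if good (Finset.univ.filter (σ · = c)).card then 0 else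
      ((Finset.univ.filter (σ · = c)).card : ℝ≥0∞)) with hNbad
  set 𝒯 : ℝ≥0∞ := ∑ σ : Fin (n + 1) → Fin (K ^ 3), ∑ c,
    (if good (Finset.univ.filter (σ · = c)).card then ∫⁻ X in cellSet K s σ, fout σ c X else 0)
    with h𝒯
  set 𝒩 : ℝ≥0∞ := ∑ σ : Fin (n + 1) → Fin (K ^ 3), Nbad σ * mass σ with h𝒩
  have hsum_card : ∀ σ : Fin (n + 1) → Fin (K ^ 3),
      ∑ c, (Finset.univ.filter (σ · = c)).card = n + 1 := fun σ =>
    (Finset.card_eq_sum_card_fiberwise (f := σ) (s := Finset.univ) (t := Finset.univ)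
      fun _ _ => Finset.mem_univ _).symm.trans (by simp)
  ----------------------------------------------------------------
  -- Step 1: the depletion identity and the slice bound
  ----------------------------------------------------------------
  have hid := occupation_add_depletion_eq_cellN hs hL hKs hψ hsymm hnorm
  have hdep := depletion_le_cellSet_sums (N := n + 1) hs hK hψ good Rf h41 hW
  rw [hKs] at hdep
  -- Step 2: fibrewise rewriting of the three particle sums
  have hout_pt : ∀ (σ : Fin (n + 1) → Fin (K ^ 3)) (X : Config (n + 1)),
      (∑ i : Fin (n + 1), if good (Finset.univ.filter (σ · = σ i)).card then
        {Y : Config (n + 1) | ∀ j, j ≠ i → σ j = σ i →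
          Rf (Finset.univ.filter (σ · = σ i)).card ≤ dist (Y i) (Y j)}.indicator
          (partialGradSq i ψ) X else 0) =
      ∑ c, (if good (Finset.univ.filter (σ · = c)).card then fout σ c X else 0) := by
    intro σ X
    rw [sum_eq_sum_fiber_orderEmb σ]
    refine Finset.sum_congr rfl fun c _ => ?_
    rw [hfout, ← sum_ite_const_zero]
    refine Finset.sum_congr rfl fun i _ => ?_
    rw [apply_orderEmbOfFin_eq σ c i]
    by_cases hg : good (Finset.univ.filter (σ · = c)).card
    · simp only [hg, if_true]
      by_cases hX : X ∈ nearSetOn ((Finset.univ.filter (σ · = c)).orderEmbOfFin rfl).toEmbedding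
        (Rf (Finset.univ.filter (σ · = c)).card) i
      · rw [Set.indicator_of_notMem (fun h => ((mem_farConfig_iff_not_mem_nearSetOn σ c _ i X).1
          (by rw [apply_orderEmbOfFin_eq σ c i]; exact h)) hX),
          Set.indicator_of_notMem (fun h => (Set.mem_compl_iff _ _).1 h hX)]
      · rw [Set.indicator_of_mem (show X ∈ _ from by
            have := (mem_farConfig_iff_not_mem_nearSetOn σ c
              (Rf (Finset.univ.filter (σ · = c)).card) i X).2 hX
            rw [apply_orderEmbOfFin_eq σ c i] at this; exact this),
          Set.indicator_of_mem (show X ∈ (nearSetOn _ _ i)ᶜ from hX)]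
    · simp only [hg, if_false]
  have hkin_pt : ∀ (σ : Fin (n + 1) → Fin (K ^ 3)) (X : Config (n + 1)),
      (∑ i : Fin (n + 1),
        if good (Finset.univ.filter (σ · = σ i)).card then partialGradSq i ψ X else 0) =
      ∑ c, (if good (Finset.univ.filter (σ · = c)).card then
        kineticOn ((Finset.univ.filter (σ · = c)).orderEmbOfFin rfl) ψ X else 0) := by
    intro σ X
    rw [sum_eq_sum_fiber_orderEmb σ]
    refine Finset.sum_congr rfl fun c _ => ?_
    simp only [apply_orderEmbOfFin_eq σ c, sum_ite_const_zero]
    rfl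
  have hbad_pt : ∀ (σ : Fin (n + 1) → Fin (K ^ 3)) (X : Config (n + 1)),
      (∑ i : Fin (n + 1), if good (Finset.univ.filter (σ · = σ i)).card then (0 : ℝ≥0∞) else
        (‖ψ X‖₊ : ℝ≥0∞) ^ 2) =
      Nbad σ * (‖ψ X‖₊ : ℝ≥0∞) ^ 2 := by
    intro σ X
    rw [sum_eq_sum_fiber_orderEmb σ, hNbad, Finset.sum_mul]
    refine Finset.sum_congr rfl fun c _ => ?_
    simp only [apply_orderEmbOfFin_eq σ c]
    by_cases hg : good (Finset.univ.filter (σ · = c)).card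
    · simp [hg]
    · simp [hg]
  simp only [hout_pt, hkin_pt, hbad_pt] at hdep
  ----------------------------------------------------------------
  -- Step 3: identify the three terms of the slice bound
  ----------------------------------------------------------------
  have hT_eq : ∀ σ : Fin (n + 1) → Fin (K ^ 3),
      ∫⁻ X in cellSet K s σ,
          ∑ c, (if good (Finset.univ.filter (σ · = c)).card then fout σ c X else 0) =
        ∑ c, (if good (Finset.univ.filter (σ · = c)).card then
          ∫⁻ X in cellSet K s σ, fout σ c X else 0) := by
    intro σ
    rw [lintegral_finsetSum _ fun c _ => measurable_ite_const _ (hmfout σ c) measurable_const]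
    exact Finset.sum_congr rfl fun c _ => lintegral_ite_const_zero _ _ _
  have hN_eq : ∀ σ : Fin (n + 1) → Fin (K ^ 3),
      ∫⁻ X in cellSet K s σ, Nbad σ * (‖ψ X‖₊ : ℝ≥0∞) ^ 2 = Nbad σ * mass σ := fun σ =>
    lintegral_const_mul _ (measurable_normSq hcont)
  have hEgrp_m : ∀ (σ : Fin (n + 1) → Fin (K ^ 3)) (c : Fin (K ^ 3)), Measurable fun X =>
      kineticOn ((Finset.univ.filter (σ · = c)).orderEmbOfFin rfl) ψ X +
        interactionOn ((Finset.univ.filter (σ · = c)).orderEmbOfFin rfl) v X *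
          (‖ψ X‖₊ : ℝ≥0∞) ^ 2 := fun σ c =>
    (measurable_kineticOn _ hψ).add ((measurable_interactionOn _ hv).mul
      (measurable_normSq hcont))
  have hEsum : ∑ σ : Fin (n + 1) → Fin (K ^ 3), ∑ c, Egrp σ c ≤ ENNReal.ofReal Ur :=
    (sum_sum_groupEnergy_le_energy_cellN hs hKs hv hψ).trans hE
  have hK_le : ∑ σ : Fin (n + 1) → Fin (K ^ 3), ∫⁻ X in cellSet K s σ,
      ∑ c, (if good (Finset.univ.filter (σ · = c)).card then
        kineticOn ((Finset.univ.filter (σ · = c)).orderEmbOfFin rfl) ψ X else 0) ≤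
        ENNReal.ofReal Ur := by
    refine le_trans (Finset.sum_le_sum fun σ _ => ?_) hEsum
    rw [hEgrp, ← lintegral_finsetSum _ fun c _ => hEgrp_m σ c]
    refine lintegral_mono fun X => Finset.sum_le_sum fun c _ => ?_
    by_cases hg : good (Finset.univ.filter (σ · = c)).card
    · simp only [hg, if_true]; exact le_self_add
    · simp only [hg, if_false]; exact bot_le
  simp only [hT_eq, hN_eq] at hdep
  -- now: hdep : D ≤ C (s² 𝒯 + w 𝒦') + 𝒩
  ----------------------------------------------------------------
  -- Step 4: energy bookkeeping per group
  ----------------------------------------------------------------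
  have hgrp : ∀ (σ : Fin (n + 1) → Fin (K ^ 3)) (c : Fin (K ^ 3)),
      ENNReal.ofReal (lb (Finset.univ.filter (σ · = c)).card) * mass σ +
        ENNReal.ofReal (1 / 2) * (if good (Finset.univ.filter (σ · = c)).card then
          ∫⁻ X in cellSet K s σ, fout σ c X else 0) ≤ Egrp σ c := by
    intro σ c
    by_cases hg : good (Finset.univ.filter (σ · = c)).card
    · obtain ⟨hy0, hy1⟩ := hy _ hg
      have h := locGroundStateEnergy_mul_add_outside_le σ c hy0 (by linarith)
        (Rf (Finset.univ.filter (σ · = c)).card) hv hψ (K := K) (s := s)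
      simp only [hg, if_true]
      refine le_trans (add_le_add (mul_le_mul_left (hloc _ hg) _)
        (mul_le_mul_left (ENNReal.ofReal_le_ofReal (by linarith)) _)) h
    · simp only [hg, if_false, mul_zero, add_zero]
      exact le_trans (mul_le_mul_left (hE0 _ hg) _)
        (neumannGroundStateEnergy_mul_le_cellSet σ c hv hψ)
  set Λ : ℝ≥0∞ := ∑ σ : Fin (n + 1) → Fin (K ^ 3),
    (∑ c, ENNReal.ofReal (lb (Finset.univ.filter (σ · = c)).card)) * mass σ with hΛ
  have h4 : Λ + ENNReal.ofReal (1 / 2) * 𝒯 ≤ ENNReal.ofReal Ur := by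
    refine le_trans (le_of_eq ?_) ((Finset.sum_le_sum fun σ _ => Finset.sum_le_sum fun c _ =>
      hgrp σ c).trans hEsum)
    rw [hΛ, h𝒯, Finset.mul_sum, ← Finset.sum_add_distrib]
    refine Finset.sum_congr rfl fun σ _ => ?_
    rw [Finset.sum_mul, Finset.mul_sum, ← Finset.sum_add_distrib]
  have h4c : ENNReal.ofReal A + ENNReal.ofReal κ * 𝒩 ≤ Λ + ENNReal.ofReal B := by
    have hmass1 : ∑ σ : Fin (n + 1) → Fin (K ^ 3), mass σ = 1 :=
      sum_mass_cellSet_eq_one_cellN hs hK hKs hnorm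
    have hσ : ∀ σ : Fin (n + 1) → Fin (K ^ 3),
        (ENNReal.ofReal A + ENNReal.ofReal κ * Nbad σ) * mass σ ≤
          ((∑ c, ENNReal.ofReal (lb (Finset.univ.filter (σ · = c)).card)) + ENNReal.ofReal B) *
            mass σ := fun σ =>
      mul_le_mul_left (hcomb (fun c => (Finset.univ.filter (σ · = c)).card) (hsum_card σ)) _
    have := Finset.sum_le_sum fun σ (_ : σ ∈ Finset.univ) => hσ σ
    calc ENNReal.ofReal A + ENNReal.ofReal κ * 𝒩
        = ∑ σ : Fin (n + 1) → Fin (K ^ 3),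
            (ENNReal.ofReal A + ENNReal.ofReal κ * Nbad σ) * mass σ := by
          rw [h𝒩, Finset.mul_sum]
          simp only [add_mul, Finset.sum_add_distrib, ← Finset.mul_sum, hmass1, mul_one,
            mul_assoc]
      _ ≤ ∑ σ : Fin (n + 1) → Fin (K ^ 3),
          ((∑ c, ENNReal.ofReal (lb (Finset.univ.filter (σ · = c)).card)) + ENNReal.ofReal B) *
            mass σ := this
      _ = Λ + ENNReal.ofReal B := by
          rw [hΛ]
          simp only [add_mul, Finset.sum_add_distrib, ← Finset.mul_sum, hmass1, mul_one]
  have h4d : ENNReal.ofReal A + (ENNReal.ofReal κ * 𝒩 + ENNReal.ofReal (1 / 2) * 𝒯) ≤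
      ENNReal.ofReal (Ur + B) := by
    calc ENNReal.ofReal A + (ENNReal.ofReal κ * 𝒩 + ENNReal.ofReal (1 / 2) * 𝒯)
        = (ENNReal.ofReal A + ENNReal.ofReal κ * 𝒩) + ENNReal.ofReal (1 / 2) * 𝒯 := by ring1
      _ ≤ (Λ + ENNReal.ofReal B) + ENNReal.ofReal (1 / 2) * 𝒯 := add_le_add h4c le_rfl
      _ = (Λ + ENNReal.ofReal (1 / 2) * 𝒯) + ENNReal.ofReal B := by ring1
      _ ≤ ENNReal.ofReal Ur + ENNReal.ofReal B := add_le_add h4 le_rfl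
      _ = ENNReal.ofReal (Ur + B) := (ENNReal.ofReal_add hUr hB).symm
  ----------------------------------------------------------------
  -- Step 5: the depletion is at most the budget `2Cs²(U + B - A) + CwU`
  ----------------------------------------------------------------
  have hX : ENNReal.ofReal κ * 𝒩 + ENNReal.ofReal (1 / 2) * 𝒯 ≤ ENNReal.ofReal (Ur + B - A) := by
    rw [ENNReal.ofReal_sub _ hA]
    exact ENNReal.le_sub_of_add_le_left ENNReal.ofReal_ne_top h4d
  have hCs : 0 ≤ 2 * C * s ^ 2 := by positivity
  have hD : ∑ i : Fin (n + 1), (ENNReal.ofReal L ^ 3)⁻¹ * ∫⁻ X in cellN (n + 1) L,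
      ∑ q : SubIdx K, ∫⁻ x in subCell s q, (‖ψ (Function.update X i x) -
        ⨍ y in subCell s q, ψ (Function.update X i y)‖₊ : ℝ≥0∞) ^ 2 ≤
      ENNReal.ofReal (2 * C * s ^ 2 * (Ur + B - A) + C * w * Ur) := by
    refine hdep.trans ?_
    have h1 : ENNReal.ofReal C * (ENNReal.ofReal (s ^ 2) * 𝒯 + ENNReal.ofReal w *
        ∑ σ : Fin (n + 1) → Fin (K ^ 3), ∫⁻ X in cellSet K s σ, ∑ c,
          (if good (Finset.univ.filter (σ · = c)).card then
            kineticOn ((Finset.univ.filter (σ · = c)).orderEmbOfFin rfl) ψ X else 0)) ≤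
        ENNReal.ofReal (2 * C * s ^ 2) * (ENNReal.ofReal (1 / 2) * 𝒯) +
          ENNReal.ofReal (C * w * Ur) := by
      calc _ ≤ ENNReal.ofReal C *
            (ENNReal.ofReal (s ^ 2) * 𝒯 + ENNReal.ofReal w * ENNReal.ofReal Ur) := by
            gcongr
        _ = _ := by
            rw [mul_add, ← mul_assoc, ← mul_assoc, ← mul_assoc, ← ENNReal.ofReal_mul hC,
              ← ENNReal.ofReal_mul hCs, ← ENNReal.ofReal_mul hC,
              ← ENNReal.ofReal_mul (by positivity)]
            congr 2; congr 1; ring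
    have h2 : 𝒩 ≤ ENNReal.ofReal (2 * C * s ^ 2) * (ENNReal.ofReal κ * 𝒩) := by
      rw [← mul_assoc, ← ENNReal.ofReal_mul hCs]
      exact le_mul_of_one_le_left bot_le (ENNReal.one_le_ofReal.2 hκ)
    calc _ ≤ ENNReal.ofReal (2 * C * s ^ 2) * (ENNReal.ofReal (1 / 2) * 𝒯) +
          ENNReal.ofReal (C * w * Ur) + ENNReal.ofReal (2 * C * s ^ 2) * (ENNReal.ofReal κ * 𝒩) :=
          add_le_add h1 h2
      _ = ENNReal.ofReal (2 * C * s ^ 2) * (ENNReal.ofReal κ * 𝒩 + ENNReal.ofReal (1 / 2) * 𝒯) +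
          ENNReal.ofReal (C * w * Ur) := by ring1
      _ ≤ ENNReal.ofReal (2 * C * s ^ 2) * ENNReal.ofReal (Ur + B - A) +
          ENNReal.ofReal (C * w * Ur) := by gcongr
      _ = ENNReal.ofReal (2 * C * s ^ 2 * (Ur + B - A) + C * w * Ur) := by
          rw [← ENNReal.ofReal_mul hCs, ← ENNReal.ofReal_add (by nlinarith) (by positivity)]
  ----------------------------------------------------------------
  -- Step 6: conclude from the identity
  ----------------------------------------------------------------
  rw [← hid]
  exact add_le_add le_rfl hD

/-- **The floor with an arbitrary budget fraction on the cellN carrier (E2)**: under the hypotheses of `cellN_engine`, if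
`2Cs²(U + B − A) + CwU ≤ η(n+1)` then `(1−η)(n+1) ≤ ∑_q ⟨u_q, γ_{1_{cellN}ψ} u_q⟩`. [cite: LSSY2005, (5.15)–(5.17); folklore] -/
theorem cellN_floor_of_budget {n K : ℕ} {s L : ℝ} (hs : 0 < s) (hK : 0 < K) (hKs : (K : ℝ) * s = L)
    (hL : 0 < L) {v : ℝ → ℝ≥0∞} (hv : Measurable v) {ψ : Config (n + 1) → ℂ} (hψ : ContDiff ℝ 1 ψ)
    (hsymm : ∀ (σ : Equiv.Perm (Fin (n + 1))) (X : Config (n + 1)), ψ (X ∘ σ) = ψ X)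
    (hnorm : ∫⁻ X in cellN (n + 1) L, (‖ψ X‖₊ : ℝ≥0∞) ^ 2 = 1)
    (good : ℕ → Prop) [DecidablePred good] (Rf yf lb : ℕ → ℝ) {C w Ur A B κ η : ℝ}
    (hC : 0 ≤ C) (hw : 0 ≤ w) (hUr : 0 ≤ Ur) (hA : 0 ≤ A) (hB : 0 ≤ B) (hη : 0 ≤ η)
    (h41 : ∀ (L : ℝ), 0 < L → ∀ (f : Space → ℂ), ContDiff ℝ 1 f →
      ∀ (Ω : Set Space), MeasurableSet Ω → Ω ⊆ cell L →
        ∫⁻ x in cell L, (‖f x - ⨍ y in cell L, f y‖₊ : ℝ≥0∞) ^ 2 ≤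
          ENNReal.ofReal C *
            (ENNReal.ofReal (L ^ 2) * (∫⁻ x in Ω, gradSqC f x) +
              volume (cell L \ Ω) ^ (2 / 3 : ℝ) * ∫⁻ x in cell L, gradSqC f x))
    (hW : ∀ m : ℕ, good (m + 1) →
      ((m : ℝ≥0∞) * (ENNReal.ofReal (Rf (m + 1)) ^ 3 * ENNReal.ofReal (Real.pi * 4 / 3))) ^
        (2 / 3 : ℝ) ≤ ENNReal.ofReal w)
    (hy : ∀ m, good m → 0 ≤ yf m ∧ yf m ≤ 1 / 2)
    (hloc : ∀ m, good m → ENNReal.ofReal (lb m) ≤ locGroundStateEnergy (yf m) (Rf m) v m s)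
    (hE0 : ∀ m, ¬ good m → ENNReal.ofReal (lb m) ≤ neumannGroundStateEnergy v m s)
    (hcomb : ∀ nv : Fin (K ^ 3) → ℕ, ∑ c, nv c = n + 1 →
      ENNReal.ofReal A + ENNReal.ofReal κ * ∑ c, (if good (nv c) then 0 else (nv c : ℝ≥0∞)) ≤
        (∑ c, ENNReal.ofReal (lb (nv c))) + ENNReal.ofReal B)
    (hκ : 1 ≤ 2 * C * s ^ 2 * κ)
    (hE : ∫⁻ X in cellN (n + 1) L, kineticDensity ψ X + interaction v X * (‖ψ X‖₊ : ℝ≥0∞) ^ 2 ≤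
      ENNReal.ofReal Ur)
    (hUBA : A ≤ Ur + B) (hbudget : 2 * C * s ^ 2 * (Ur + B - A) + C * w * Ur ≤ η * (n + 1)) :
    ENNReal.ofReal ((1 - η) * (n + 1)) ≤
      ∑ q : SubIdx K, occupation (n + 1) (subMode s q) ((cellN (n + 1) L).indicator ψ) := by
  have h := cellN_engine n K s L hs hK hKs hL v hv ψ hψ hsymm hnorm good Rf yf lb C w Ur A B κ hC hw hUr hA hB
    h41 hW hy hloc hE0 hcomb hκ hE hUBA
  rcases le_or_gt 1 η with hη1 | hη1
  · rw [ENNReal.ofReal_of_nonpos (mul_nonpos_of_nonpos_of_nonneg (by linarith) (by positivity))]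
    exact bot_le
  have hsplit : ((n + 1 : ℕ) : ℝ≥0∞) =
      ENNReal.ofReal ((1 - η) * (n + 1)) + ENNReal.ofReal (η * (n + 1)) := by
    rw [← ENNReal.ofReal_add (mul_nonneg (by linarith) (by positivity)) (by positivity),
      ← ENNReal.ofReal_natCast]
    congr 1; push_cast; ring1
  have hfin : ENNReal.ofReal ((1 - η) * (n + 1)) + ENNReal.ofReal (η * (n + 1)) ≤
      (∑ q : SubIdx K, occupation (n + 1) (subMode s q) ((cellN (n + 1) L).indicator ψ)) +
        ENNReal.ofReal (η * (n + 1)) := by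
    rw [← hsplit]
    exact h.trans (add_le_add le_rfl (ENNReal.ofReal_le_ofReal hbudget))
  exact (ENNReal.add_le_add_iff_right ENNReal.ofReal_ne_top).1 hfin

end Summit.AtomisticToContinuum.BoseEinsteinCondensation.Theorems.BlockLatticeFSumBlockCondensationCellNTransport

end
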